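import Summits.Ventures.Crystal3D.Theorems.StickyWulffConstantGenericWallFloorStackLedgerOneSidedWide
import Summits.Ventures.Crystal3D.Theorems.StickyWulffConstantGenericWallFloorStackWalkInjectiveSteer
import Summits.Ventures.Crystal3D.Theorems.StickyWulffConstantGenericWallFloorWalkDriftFloor
import HarnessLib

/-!
# The W1-CONDITIONAL one-sided stack ledger: ANY steering vertical, WEAK direction floor `hdirs`, rim counting
# (crux `GenericWallFloor`, stmt-Ventures-19480, line `WallLedgerG`; cf-p1 §86(55) AX / (xxxix) item 3; memo SWEPT-LEDGER-FLOOR-g7 §4)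

HONEST FRAMING. Venture `Summits/Ventures/Crystal3D` (cell `crystal3d-full`), helper `--supports` the crux `GenericWallFloor`
(stmt-Ventures-19480) of `route-Ventures-StickyWulffConstant`, registered line `WallLedgerG`, open stub `stub_twoSlabAdhesion`.
Rung credit only; F-C1 not moved; NOT the stub.  CONDITIONAL on the hypothesis `hdirs` (lane G's W1: discharged per walker family
by 19480-p1, not here).

`twoSlabAdhesion_stackLedger_oneSided_wide` pays `½κ₁` from grain 1's `z`-walkers when the steering vertical `z` is within `1/3` of
`e₃`: the tilt makes every step rise in TRUE height, which gives (i) «end not below start», (ii) a drift bound keeping the ends inside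
the cell's inner disc, (iii) the deep-prefix injectivity.  Beyond tilt `22°` the drift bound is false (memo SWEPT-LEDGER-FLOOR-g7:
`e₃`-descending held directions re-enter the floor).  This file removes the tilt hypothesis altogether:

* the steering `z` is ANY unit vector (`hz`), the launch slot `u₁` is `z`-steep (`hsteep₁`) and rises in TRUE height by `δ > 0`
  (`hup : δ ≤ (A₁ u₁) 2` — a number of the plate, not of the dynamics);
* **`hdirs`** (WEAK direction floor, the W1 hypothesis): the TOP direction of every sound well-formed stack over the family's bottom
  entry `⟨A₁, u₁, 0⟩` has non-negative true height, `0 ≤ (e.frame e.dir) 2` — same quantifier shape as `hM₁`, so it is discharged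
  by an invariant on (frame, slot) by induction up the stack (push = best capper of the twin frame across an admissible normal);
* (i) follows from `hdirs` alone (`walkRun_drift_of_dirFloor` with floor `0`: every step displaces by the NEW top direction);
  (ii) is DROPPED — an end of lateral radius `> ρ − 2` sits on a RIM ball, which carries at most `12` end states
  (`card_contacts_add_endStates_le_twelve_sep` needs only `deg ≤ 11`), and there are `≤ 48(h+42)(ρ−1)` rim balls (`card_cellRim_le`);
  (iii) is 19480-p1's steering-free `walkRun_start_injective_steer` (`…StackWalkInjectiveSteer`: backward line above the floor,
  room `ρs + 9/δ ≤ ρ − 2`), so the inner start disc is `ρs = ρ − 3 − 9/δ`.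
Result **`twoSlabAdhesion_stackLedger_oneSided_dirs`**: OneSidedWide's conclusion verbatim (`½κ₁` paid, `κ₁ = √2|⟪A₁u₁, e₃⟫|`,
no residual), constant `C = C(δ)`.
WHAT THIS IS NOT: not the stub; `hdirs` is NOT discharged here (19480-p1 g9: sign invariant of the terrace-normal / swept steered
families); E1 (`hcert`) and StarPairFar (`hDS`, `hCP`) remain named inputs; F-C1 not moved.
-/

noncomputable section

namespace Summit.Ventures.Crystal3D.Theorems

open Summit.Ventures.Crystal3D Finset
open Literature.MathematicalPhysics.StatisticalMechanics (fccStacking barlowStacking IsHaggSeq contactDeficiency)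
open scoped InnerProductSpace

variable {X : Finset (EuclideanSpace ℝ (Fin 3))}

/-! ### Weak direction floor ⇒ true heights never decrease -/

/-- **`hdirs` ⇒ the end is not below the start.**  If the top direction of every sound well-formed stack over the bottom entry
`⟨A₁, u₁, 0⟩` has non-negative true height, then along every valid run over that bottom entry the true height never drops
below its initial value (each step moves along the NEW top direction, `walkRun_drift_of_dirFloor` with floor `0`). -/
theorem walkRun_height_ge_of_dirs (hX : ∀ p ∈ X, ∀ q ∈ X, p ≠ q → 1 ≤ dist p q)
    {s₀ : EuclideanSpace ℝ (Fin 3)} (hs₀ : s₀ ∈ fccSlots)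
    (hcert : ExactOnly 0 (fccSlots.filter fun w => 0 < ⟪w, s₀⟫_ℝ))
    {z : EuclideanSpace ℝ (Fin 3)} (hz : ‖z‖ = 1)
    (A₁ : EuclideanSpace ℝ (Fin 3) ≃ₗᵢ[ℝ] EuclideanSpace ℝ (Fin 3)) (u₁ : EuclideanSpace ℝ (Fin 3))
    (hdirs : ∀ stk : List WalkEntry, StackSound z stk → StackWF z stk → stk.getLast? = some ⟨A₁, u₁, 0⟩ →
      ∀ e rest, stk = e :: rest → 0 ≤ (e.frame e.dir) 2)
    {s : EuclideanSpace ℝ (Fin 3) × List WalkEntry} (hI : WalkInv X z s) (hW : StackWF z s.2)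
    (hlast : s.2.getLast? = some ⟨A₁, u₁, 0⟩) (k : ℕ) :
    s.1 2 ≤ (walkRun X z k s).1 2 := by
  set e₃ : EuclideanSpace ℝ (Fin 3) := EuclideanSpace.single (2 : Fin 3) (1 : ℝ) with he₃
  have he₃i : ∀ d : EuclideanSpace ℝ (Fin 3), ⟪d, e₃⟫_ℝ = d 2 := fun d => by
    rw [he₃, EuclideanSpace.inner_single_right]; simp
  have h := walkRun_drift_of_dirFloor (X := X) z e₃ (δ := 0) le_rfl k s (fun j _ e rest hj => by
    obtain ⟨hIj, hWj⟩ := walkRun_valid hX hs₀ hcert hz j hI hW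
    have hlastj : (walkRun X z j s).2.getLast? = some ⟨A₁, u₁, 0⟩ := by
      rw [walkRun_getLast? hX hs₀ hcert hz j s hI, hlast]
    have hSj : StackSound z (walkRun X z j s).2 := hIj.2.1
    have hSj' : StackSound z (e :: rest) := by rw [hj] at hSj; exact hSj
    refine ⟨le_of_eq (by rw [LinearIsometryEquiv.norm_map, norm_eq_one_of_mem_fccSlots hSj'.top.1]), ?_⟩
    rw [he₃i]; exact hdirs _ hSj hWj hlastj e rest hj)
  rw [zero_mul, inner_sub_left, he₃i, he₃i] at h
  linarith

/-! ### Flux loss for an inner disc with constant room -/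

/-- **Flux loss of the inner start disc (constant room).**  For `0 ≤ κ ≤ 2`, `0 ≤ L`, `ρs = ρ − 3 − L` with `0 ≤ ρs ≤ ρ − 1`:
`κπρ² − (128 + 16L)ρ ≤ κπρs² − 10√2πρs`. -/
theorem flux_loss_inner_disc_room {κ ρ ρs L : ℝ} (hκ0 : 0 ≤ κ) (hκ2 : κ ≤ 2) (hρ0 : 0 ≤ ρ) (hL0 : 0 ≤ L)
    (hρs : ρs = ρ - 3 - L) (hρs0 : 0 ≤ ρs) (hρsρ : ρs ≤ ρ - 1) :
    κ * Real.pi * ρ ^ 2 - (128 + 16 * L) * ρ ≤ κ * Real.pi * ρs ^ 2 - 10 * Real.sqrt 2 * Real.pi * ρs := by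
  have hπ : Real.pi ≤ 4 := Real.pi_le_four; have hπ0 : 0 ≤ Real.pi := Real.pi_pos.le; have hsq : 0 ≤ Real.sqrt 2 := Real.sqrt_nonneg 2
  have hs2' : Real.sqrt 2 ≤ 2 := by
    rw [show (2 : ℝ) = Real.sqrt (2 ^ 2) by rw [Real.sqrt_sq (by norm_num)]]
    exact Real.sqrt_le_sqrt (by norm_num)
  have hκπ : κ * Real.pi ≤ 8 := by nlinarith only [hκ0, hκ2, hπ, hπ0]
  have h1 : κ * Real.pi * ρ ^ 2 - κ * Real.pi * ρs ^ 2 = κ * Real.pi * ((3 + L) * (ρ + ρs)) := by rw [hρs]; ring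
  have h0 : 0 ≤ (3 + L) * (ρ + ρs) := mul_nonneg (by linarith only [hL0]) (by linarith only [hρ0, hρs0])
  have h2 : (3 + L) * (ρ + ρs) ≤ (3 + L) * (2 * ρ) :=
    mul_le_mul_of_nonneg_left (by linarith only [hρsρ]) (by linarith only [hL0])
  have h3 : κ * Real.pi * ((3 + L) * (ρ + ρs)) ≤ 8 * ((3 + L) * (2 * ρ)) :=
    calc κ * Real.pi * ((3 + L) * (ρ + ρs)) ≤ 8 * ((3 + L) * (ρ + ρs)) :=
          mul_le_mul_of_nonneg_right hκπ h0
      _ ≤ 8 * ((3 + L) * (2 * ρ)) := by linarith only [h2]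
  have h4 : 10 * Real.sqrt 2 * Real.pi * ρs ≤ 80 * ρ := by
    have h7 : Real.sqrt 2 * Real.pi ≤ 8 := by nlinarith only [hsq, hs2', hπ, hπ0]
    have h5 : 10 * Real.sqrt 2 * Real.pi * ρs = 10 * (Real.sqrt 2 * Real.pi) * ρs := by ring
    rw [h5]; have h6 : 10 * (Real.sqrt 2 * Real.pi) * ρs ≤ 10 * 8 * ρs := mul_le_mul_of_nonneg_right (by linarith only [h7]) hρs0
    linarith only [h6, hρsρ]
  have h5 : 8 * ((3 + L) * (2 * ρ)) + 80 * ρ = (128 + 16 * L) * ρ := by ring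
  linarith only [h1, h3, h4, h5]

/-! ### The W1-conditional one-sided ledger -/

open scoped Classical in
/-- **The one-sided stack ledger for ANY steering vertical under the weak direction floor `hdirs` (grain 1 alone, charge
`½κ₁`, no residual).**  `z` any unit vector, slot `u₁` steep for `z` and rising in true height by `δ > 0`, frame set `M₁`
containing every frame of every sound well-formed `z`-stack over `(A₁, u₁, 0)`, no frame of `M₁` IS the far lattice `A₂·Λ₀`,
and `hdirs`: the top direction of every such stack has non-negative true height.  Then in every cell of `TwoSlabAdhesion`
`cross(P₁,X∖P₁) + cross(P₂,Y) ≤ D(Y) + (φ₁ + φ₂ − ½·√2|⟪A₁u₁,e₃⟫|)πρ² + C(1+h)ρ` with `C = C(δ)`. -/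
theorem twoSlabAdhesion_stackLedger_oneSided_dirs
    {s₀ : EuclideanSpace ℝ (Fin 3)} (hs₀ : s₀ ∈ fccSlots)
    (hcert : ExactOnly 0 (fccSlots.filter fun w => 0 < ⟪w, s₀⟫_ℝ))
    (hDS : ∀ F₁ F₂ : EuclideanSpace ℝ (Fin 3) ≃ₗᵢ[ℝ] EuclideanSpace ℝ (Fin 3), DoubleStarCoaxialAt F₁ F₂)
    (hCP : CapPairCoaxial)
    (A₁ : EuclideanSpace ℝ (Fin 3) ≃ₗᵢ[ℝ] EuclideanSpace ℝ (Fin 3)) (t₁ : EuclideanSpace ℝ (Fin 3))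
    (A₂ : EuclideanSpace ℝ (Fin 3) ≃ₗᵢ[ℝ] EuclideanSpace ℝ (Fin 3)) (t₂ : EuclideanSpace ℝ (Fin 3))
    {z : EuclideanSpace ℝ (Fin 3)} (hz : ‖z‖ = 1)
    {u₁ : EuclideanSpace ℝ (Fin 3)} (hu₁ : u₁ ∈ fccSlots)
    (hsteep₁ : Real.sqrt 2 / 2 ≤ ⟪A₁ u₁, z⟫_ℝ) {δ : ℝ} (hδ : 0 < δ) (hup : δ ≤ (A₁ u₁) 2)
    (M₁ : Set (EuclideanSpace ℝ (Fin 3) ≃ₗᵢ[ℝ] EuclideanSpace ℝ (Fin 3)))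
    (hM₁ : ∀ stk : List WalkEntry, StackSound z stk → StackWF z stk → stk.getLast? = some ⟨A₁, u₁, 0⟩ →
      ∀ e ∈ stk, e.frame ∈ M₁)
    (hfar : ∀ F ∈ M₁, F '' fccStacking 1 (Real.sqrt (2 / 3)) ≠ A₂ '' fccStacking 1 (Real.sqrt (2 / 3)))
    (hdirs : ∀ stk : List WalkEntry, StackSound z stk → StackWF z stk → stk.getLast? = some ⟨A₁, u₁, 0⟩ →
      ∀ e rest, stk = e :: rest → 0 ≤ (e.frame e.dir) 2) :
    ∃ C R₀ : ℝ, 1 ≤ R₀ ∧ ∀ h : ℝ, 0 ≤ h → ∀ ρ : ℝ, R₀ ≤ ρ →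
      ∀ X P₁ P₂ : Finset (EuclideanSpace ℝ (Fin 3)),
      (∀ p ∈ X, ∀ q ∈ X, p ≠ q → 1 ≤ dist p q) → P₁ ⊆ X → P₂ ⊆ X \ P₁ →
      (∀ p ∈ X, -(2 * R₀) ≤ p 2 ∧ p 2 ≤ h + 2 * R₀ ∧ p 0 ^ 2 + p 1 ^ 2 ≤ ρ ^ 2) →
      (∀ p, p ∈ P₁ ↔ (p ∈ (fun q => A₁ q + t₁) '' fccStacking 1 (Real.sqrt (2 / 3)) ∧
        -(2 * R₀) ≤ p 2 ∧ p 2 ≤ -R₀ ∧ p 0 ^ 2 + p 1 ^ 2 ≤ ρ ^ 2)) →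
      (∀ p, p ∈ P₂ ↔ (p ∈ (fun q => A₂ q + t₂) '' fccStacking 1 (Real.sqrt (2 / 3)) ∧
        h + R₀ ≤ p 2 ∧ p 2 ≤ h + 2 * R₀ ∧ p 0 ^ 2 + p 1 ^ 2 ≤ ρ ^ 2)) →
      ((((P₁ ×ˢ (X \ P₁)).filter fun pq => dist pq.1 pq.2 = 1).card : ℕ) : ℝ) +
        ((((P₂ ×ˢ ((X \ P₁) \ P₂)).filter fun pq => dist pq.1 pq.2 = 1).card : ℕ) : ℝ) ≤
        contactDeficiency ((X \ P₁) \ P₂) +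
          (Real.sqrt 2 / 4 * ∑ᶠ w ∈ {w ∈ fccStacking 1 (Real.sqrt (2 / 3)) | ‖w‖ = 1},
              |⟪w, A₁.symm (EuclideanSpace.single (2 : Fin 3) (1 : ℝ))⟫_ℝ| +
            Real.sqrt 2 / 4 * ∑ᶠ w ∈ {w ∈ fccStacking 1 (Real.sqrt (2 / 3)) | ‖w‖ = 1},
              |⟪w, A₂.symm (EuclideanSpace.single (2 : Fin 3) (1 : ℝ))⟫_ℝ| -
            Real.sqrt 2 * |⟪A₁ u₁, EuclideanSpace.single (2 : Fin 3) (1 : ℝ)⟫_ℝ| / 2) * Real.pi * ρ ^ 2 +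
          C * (1 + h) * ρ := by
  obtain ⟨C₁, hC₁⟩ := affineSampleDeficit_upper A₁ t₁ 10 (by norm_num)
  obtain ⟨C₂, hC₂⟩ := affineSampleDeficit_upper A₂ t₂ 10 (by norm_num)
  -- room `L = 9/δ` for the backward line, flux + rim constant `Cm`
  set L : ℝ := 9 / δ with hL; have hL0 : 0 ≤ L := by rw [hL]; positivity
  set Cm : ℝ := 128 + 16 * L + 24192 with hCm; have hCm0 : 0 ≤ Cm := by rw [hCm]; positivity
  refine ⟨(240 * Real.sqrt 2 * Real.pi + 4440 * (4 * 10 + 2)) / 2 + Cm + |C₁| + |C₂|, 10, by norm_num, ?_⟩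
  intro h hh ρ hρ X P₁ P₂ hX hP₁X hP₂X hcell hP₁ hP₂
  set e₃ : EuclideanSpace ℝ (Fin 3) := EuclideanSpace.single (2 : Fin 3) (1 : ℝ) with he₃
  have he₃i : ∀ d : EuclideanSpace ℝ (Fin 3), ⟪d, e₃⟫_ℝ = d 2 := fun d => by rw [he₃, EuclideanSpace.inner_single_right]; simp
  set φ₁ : ℝ := Real.sqrt 2 / 4 * ∑ᶠ w ∈ {w ∈ fccStacking 1 (Real.sqrt (2 / 3)) | ‖w‖ = 1},
      |⟪w, A₁.symm (EuclideanSpace.single (2 : Fin 3) (1 : ℝ))⟫_ℝ| with hφ₁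
  set φ₂ : ℝ := Real.sqrt 2 / 4 * ∑ᶠ w ∈ {w ∈ fccStacking 1 (Real.sqrt (2 / 3)) | ‖w‖ = 1},
      |⟪w, A₂.symm (EuclideanSpace.single (2 : Fin 3) (1 : ℝ))⟫_ℝ| with hφ₂
  have hP₂X' : P₂ ⊆ X := hP₂X.trans Finset.sdiff_subset
  obtain ⟨hρ0, hρ1⟩ : (0 : ℝ) ≤ ρ ∧ (1 : ℝ) ≤ ρ := ⟨by linarith, by linarith⟩
  -- fuel `N`, inner disc `ρs`
  set Hz : ℝ := ρ + h + 4 * 10 with hHz; have hHz0 : 0 ≤ Hz := by rw [hHz]; positivity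
  set N : ℕ := ⌈6 * Hz + 1⌉₊ with hNdef
  set ρs : ℝ := ρ - 3 - L with hρs
  set deg : EuclideanSpace ℝ (Fin 3) → ℕ := fun x => (X.filter fun q => dist x q = 1).card with hdeg
  have hdeg12 : ∀ x, deg x ≤ 12 := fun x => card_filter_dist_eq_one_le_twelve X hX x
  set PAY := X.filter fun y => (X.filter fun q => dist y q = 1).card ≠ 12 ∧
    -10 - 2 ≤ y 2 ∧ y 2 ≤ h + 10 + 2 with hPAY
  -- the RIM of the cell: lateral radius `> ρ − 2`
  set RIM := X.filter fun y => (ρ - 2) ^ 2 < y 0 ^ 2 + y 1 ^ 2 with hRIM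
  have hRIMcard : ((RIM.card : ℕ) : ℝ) ≤ 48 * (h + 2 * 10 - -(2 * 10) + 2) * (ρ - 1) := by
    rw [hRIM]; exact card_cellRim_le X hX (-(2 * 10)) (h + 2 * 10) ρ (by linarith) (by linarith) hcell
  -- the weighted interior ledger
  have hled := ledger_ge_faces_add_interior_credits A₁ t₁ A₂ t₂ X P₁ P₂ 10 h ρ le_rfl hh hρ hX hcell hP₁X hP₂X'
    hP₁ hP₂
  rw [← finsum_unit_fcc_symm_eq_sum_slots A₁, ← finsum_unit_fcc_symm_eq_sum_slots A₂, ← hφ₁, ← hφ₂, ← hPAY] at hled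
  -- heights for the steering vertical and the fuel
  have hH₁ : ∀ q ∈ X, ⟪q, z⟫_ℝ ≤ Hz := fun q hq => by
    have h1 := real_inner_le_norm q z
    rw [hz, mul_one] at h1
    exact h1.trans (norm_le_of_mem_cell (by norm_num) hh hρ0 (hcell q hq))
  have hlowz : ∀ q ∈ X, -Hz ≤ ⟪q, z⟫_ℝ := fun q hq => by
    have h1 := real_inner_le_norm (-q) z
    rw [hz, mul_one, norm_neg, inner_neg_left] at h1
    have h2 := norm_le_of_mem_cell (R₀ := 10) (by norm_num) hh hρ0 (hcell q hq)
    linarith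
  have hN : (6 : ℝ) * Hz + 1 ≤ (N : ℝ) := by rw [hNdef]; exact Nat.le_ceil _
  have hNh_of : ∀ q ∈ X, 8 * (Hz - ⟪q, z⟫_ℝ) < 3 * (N : ℝ) := fun q hq => by
    have := hlowz q hq; linarith
  -- fluxes
  set κ₁ : ℝ := Real.sqrt 2 * |⟪A₁ u₁, e₃⟫_ℝ| with hκ₁
  have hsq : 0 ≤ Real.sqrt 2 := Real.sqrt_nonneg 2; have hπ : Real.pi ≤ 4 := Real.pi_le_four; have hπ0 : 0 ≤ Real.pi := Real.pi_pos.le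
  have hs2' : Real.sqrt 2 ≤ 2 := by
    rw [show (2 : ℝ) = Real.sqrt (2 ^ 2) by rw [Real.sqrt_sq (by norm_num)]]; exact Real.sqrt_le_sqrt (by norm_num)
  have hκ₁0 : 0 ≤ κ₁ := mul_nonneg hsq (abs_nonneg _)
  have hκ₁2 : κ₁ ≤ 2 := by
    have := mul_le_mul hs2' (abs_inner_slot_le_one A₁ hu₁) (abs_nonneg _) (by norm_num); linarith
  -- a second bottom entry, different from grain 1's (the count lemma is used with an EMPTY second family)
  have hu₁0 : A₁ u₁ ≠ 0 := fun h0 => by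
    have := norm_eq_one_of_mem_fccSlots hu₁; rw [← LinearIsometryEquiv.norm_map A₁, h0, norm_zero] at this
    exact zero_ne_one this
  have hbb : (⟨A₁, u₁, 0⟩ : WalkEntry) ≠ ⟨A₁, u₁, A₁ u₁⟩ := fun hb => hu₁0 (congrArg WalkEntry.nrm hb).symm
  -- the main estimate: the payer sum dominates the tops, up to the flux loss and the rim
  have hmain : κ₁ * Real.pi * ρ ^ 2 - Cm * (1 + h) * ρ ≤
      (∑ y ∈ PAY, ((12 : ℝ) - ((X.filter fun q => dist y q = 1).card : ℝ))) := by
    have hPAY0 : 0 ≤ ∑ y ∈ PAY, ((12 : ℝ) - ((X.filter fun q => dist y q = 1).card : ℝ)) :=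
      Finset.sum_nonneg fun y _ => by
        have h'' : ((X.filter fun q => dist y q = 1).card : ℝ) ≤ 12 := by exact_mod_cast hdeg12 y
        linarith
    have hhρ : 0 ≤ h * ρ := mul_nonneg hh hρ0
    by_cases hbig : 11 + L ≤ ρ
    · -- BIG CELL: run the walkers
      have hρs8 : 8 ≤ ρs := by rw [hρs]; linarith
      have hρs0 : 0 ≤ ρs := (by linarith); have hρsρ : ρs ≤ ρ - 1 := by rw [hρs]; linarith only [hL0]
      have hρs2 : ρs ^ 2 ≤ ρ ^ 2 := by nlinarith only [hρs0, hρsρ]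
      have hρs3 : ρs ^ 2 ≤ (ρ - 1) ^ 2 := by nlinarith only [hρs0, hρsρ]
      -- the inner sample, tops and end-state map
      set S₁ := P₁.filter fun p => (-19 : ℝ) ≤ p 2 ∧ p 2 ≤ -19 + 8 ∧ p 0 ^ 2 + p 1 ^ 2 ≤ ρs ^ 2 with hS₁def
      set T₁ := S₁.filter fun p => p + A₁ u₁ ∉ S₁ with hT₁def
      set f₁ : EuclideanSpace ℝ (Fin 3) → EuclideanSpace ℝ (Fin 3) × List WalkEntry :=
        fun p => walkRun X z N (p + A₁ u₁, [⟨A₁, u₁, 0⟩]) with hf₁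
      have hS₁mem : ∀ p, p ∈ S₁ ↔ (p ∈ P₁ ∧ (-19 : ℝ) ≤ p 2 ∧ p 2 ≤ -19 + 8 ∧ p 0 ^ 2 + p 1 ^ 2 ≤ ρs ^ 2) :=
        fun p => by rw [hS₁def, Finset.mem_filter]
      have hS₁ : ∀ p, p ∈ S₁ ↔ (p ∈ (fun q => A₁ q + t₁) '' fccStacking 1 (Real.sqrt (2 / 3)) ∧
          (-19 : ℝ) ≤ p 2 ∧ p 2 ≤ -19 + 8 ∧ p 0 ^ 2 + p 1 ^ 2 ≤ ρs ^ 2) := by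
        intro p
        rw [hS₁def, Finset.mem_filter, hP₁]
        constructor
        · rintro ⟨⟨hΛ, -, -, -⟩, h1, h2, h3⟩; exact ⟨hΛ, by linarith only [h1], by linarith only [h2], h3⟩
        · rintro ⟨hΛ, h1, h2, h3⟩
          exact ⟨⟨hΛ, by linarith only [h1], by linarith only [h2], by linarith only [h3, hρs2]⟩, h1, h2, h3⟩
      -- the tops count
      obtain ⟨Ea, Eb, hEa, hEb, hdet, hframe, -⟩ := exists_frame_of_mem_fccSlots hu₁
      have hT₁ := tops_ge_lineCount A₁ t₁ (-19) 8 ρs (by norm_num) hρs8 S₁ hS₁ Ea Eb u₁ hEa hEb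
        (norm_eq_one_of_mem_fccSlots hu₁) hdet hframe
      have hT₁' : κ₁ * Real.pi * ρs ^ 2 - 10 * Real.sqrt 2 * Real.pi * ρs ≤ (T₁.card : ℝ) := by rw [hT₁def]; exact hT₁
      have hT₁'' : κ₁ * Real.pi * ρ ^ 2 - (128 + 16 * L) * ρ ≤ (T₁.card : ℝ) :=
        le_trans (flux_loss_inner_disc_room hκ₁0 hκ₁2 hρ0 hL0 (by rw [hρs]) hρs0 hρsρ) hT₁'
      have hsq_of_sqrt : ∀ (p : EuclideanSpace ℝ (Fin 3)), Real.sqrt (p 0 ^ 2 + p 1 ^ 2) ≤ ρ - 1 →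
          p 0 ^ 2 + p 1 ^ 2 ≤ (ρ - 1) ^ 2 := by
        intro p hp
        have h7 := pow_le_pow_left₀ (Real.sqrt_nonneg (p 0 ^ 2 + p 1 ^ 2)) hp 2
        rwa [Real.sq_sqrt (by positivity : (0 : ℝ) ≤ p 0 ^ 2 + p 1 ^ 2)] at h7
      -- GRAIN 1: fullness of the sample, end data, injectivity
      have hfull₁ : ∀ p ∈ S₁, p ∈ X ∧ ∀ w ∈ fccSlots, p + A₁ w ∈ X := by
        intro p hpS
        obtain ⟨hpΛ, hp1, hp2, hp3⟩ := (hS₁ p).1 hpS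
        exact ⟨hP₁X ((hS₁mem p).1 hpS).1, fun w hw => hP₁X (inner_sample_full_window A₁ t₁ P₁ (-(2 * 10)) (-10) ρ hρ1
          hP₁ hpΛ (by linarith only [hp1]) (by linarith only [hp2]) (by linarith only [hp3, hρs3]) hw)⟩
      have hend₁ : ∀ t ∈ T₁, (f₁ t).1 ∈ X ∧ deg (f₁ t).1 ≤ 11 ∧ WalkInv X z (f₁ t) ∧ StackWF z (f₁ t).2 ∧
          (f₁ t).2.getLast? = some ⟨A₁, u₁, 0⟩ ∧ (∃ e rest, (f₁ t).2 = e :: rest ∧ WalkCertified12 X (f₁ t).1 e) ∧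
          (∀ e ∈ (f₁ t).2, e.frame ∈ M₁) ∧
          ((f₁ t).1 0 ^ 2 + (f₁ t).1 1 ^ 2 ≤ (ρ - 2) ^ 2 → (f₁ t).1 ∈ PAY) := by
        intro p hp
        have hpS : p ∈ S₁ := by rw [hT₁def] at hp; exact (Finset.mem_filter.1 hp).1
        obtain ⟨hpΛ, hp1, hp2, hp3⟩ := (hS₁ p).1 hpS
        obtain ⟨hpX, hfull⟩ := hfull₁ p hpS
        have hy0X : p + A₁ u₁ ∈ X := hfull u₁ hu₁
        have hNh : 8 * (Hz - ⟪p + A₁ u₁, z⟫_ℝ) < 3 * (N : ℝ) := hNh_of _ hy0X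
        have hI₀ : WalkInv X z (p + A₁ u₁, [⟨A₁, u₁, 0⟩]) := walkInv_start A₁ hpX hfull hu₁ hsteep₁
        obtain ⟨hyX, hydeg, -, -, -, -⟩ := stackWalk_end hX hs₀ hcert hz hH₁ hI₀ hNh
        have hfw' : walkRun X z N (p + A₁ u₁, [⟨A₁, u₁, 0⟩]) = f₁ p := rfl
        rw [hfw'] at hyX hydeg
        have hvalid := walkRun_valid hX hs₀ hcert hz N hI₀ (stackWF_start z A₁ u₁)
        have hlast₁ : (f₁ p).2.getLast? = some ⟨A₁, u₁, 0⟩ := by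
          rw [← hfw', walkRun_getLast? hX hs₀ hcert hz N _ hI₀]; rfl
        have hfrM : ∀ e ∈ (f₁ p).2, e.frame ∈ M₁ := hM₁ (f₁ p).2 hvalid.1.2.1 hvalid.2 hlast₁
        -- the end is not below the start (weak direction floor)
        have hrise : (p + A₁ u₁) 2 ≤ (f₁ p).1 2 :=
          walkRun_height_ge_of_dirs hX hs₀ hcert hz A₁ u₁ hdirs hI₀ (stackWF_start z A₁ u₁) rfl N
        have hy0eq : (p + A₁ u₁) 2 = p 2 + (A₁ u₁) 2 := by simp
        refine ⟨hyX, hydeg, hvalid.1, hvalid.2, hlast₁, ?_, hfrM, fun hlat2 => ?_⟩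
        · rw [← hfw']
          exact walkRun_certified12 hX hs₀ hcert hz hI₀ ⟨⟨A₁, u₁, 0⟩, [], rfl, Or.inl ⟨by simpa using hpX,
            fun w hw => by simp only [add_sub_cancel_right]; exact hfull w hw⟩⟩ N
        · -- INNER end: not high (sealing of the top plate, `hfar`), not low (monotone height + sealing below)
          have hnothigh := stackWalk_end_not_high_sep hX hs₀ hcert A₂ t₂ P₂ 10 h ρ (by linarith only [hρ]) hP₂X'
            (fun q hq => (hcell q hq).2.1) hP₂ hz hH₁ hI₀ hNh
            (fun e' he' => hfar e'.frame (hfrM e' (by rw [← hfw']; exact he'))) hlat2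
          rw [hfw'] at hnothigh
          have hylat : (f₁ p).1 0 ^ 2 + (f₁ p).1 1 ^ 2 ≤ (ρ - 1) ^ 2 := le_trans hlat2 (by nlinarith only [hρ])
          rw [hPAY, Finset.mem_filter]
          refine ⟨hyX, by show deg _ ≠ 12; exact fun h12 => by simp only [hdeg] at h12; omega, ?_, le_of_lt hnothigh⟩
          by_contra hlow; push Not at hlow
          exact not_unsaturated_in_slab A₁ t₁ (-(2 * 10)) (-10) ρ hρ1 X P₁ hX hP₁X hP₁ hyX
            (by linarith only [hrise, hy0eq, hp1, hup, hδ]) (by linarith only [hlow]) hylat hydeg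
      have hinj₁ : ∀ t ∈ T₁, ∀ t' ∈ T₁, f₁ t = f₁ t' → t = t' := by
        intro t ht t' ht' hft; rw [hT₁def, Finset.mem_filter] at ht ht'
        refine walkRun_start_injective_steer hX hs₀ hcert hz A₁ t₁ hu₁ hsteep₁ hδ hup P₁ (a := -(2 * 10)) (b := -10)
          (r := ρs) (by linarith only [hρ]) (by norm_num) hP₁X hP₁ (fun q hq => (hcell q hq).1) hρs0
          (by rw [hρs, hL]; norm_num; linarith) S₁ (Finset.filter_subset _ _)
          (fun p hp => ⟨by linarith only [((hS₁mem p).1 hp).2.2.1], ((hS₁mem p).1 hp).2.2.2⟩)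
          (fun p hp => (hfull₁ p hp).2)
          (sample_interval A₁ t₁ P₁ S₁ hρs0 (by linarith only [hρsρ]) (by norm_num) (by norm_num) hP₁ hS₁mem hu₁)
          ht.1 ht.2 ht'.1 ht'.2 hft
      -- the END CLASSES: inner payers and rim balls (disjoint)
      set PAYin := PAY.filter fun y => y 0 ^ 2 + y 1 ^ 2 ≤ (ρ - 2) ^ 2 with hPAYin
      have hdisj : Disjoint PAYin RIM := by
        rw [Finset.disjoint_left]; intro y hy hy'
        rw [hPAYin, Finset.mem_filter] at hy; rw [hRIM, Finset.mem_filter] at hy'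
        exact absurd hy.2 (not_le.2 hy'.2)
      have hendD : ∀ t ∈ T₁, (f₁ t).1 ∈ PAYin ∪ RIM := by
        intro t ht
        obtain ⟨hyX, -, -, -, -, -, -, hpay⟩ := hend₁ t ht
        rw [Finset.mem_union]
        by_cases hlat : (f₁ t).1 0 ^ 2 + (f₁ t).1 1 ^ 2 ≤ (ρ - 2) ^ 2
        · exact Or.inl (by rw [hPAYin, Finset.mem_filter]; exact ⟨hpay hlat, hlat⟩)
        · exact Or.inr (by rw [hRIM, Finset.mem_filter]; exact ⟨hyX, not_le.1 hlat⟩)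
      -- THE COUNT: per end ball, `deg + #fibre₁ ≤ 12` (the two-family count lemma with an EMPTY second family)
      have hpt : ∀ y ∈ PAYin ∪ RIM, deg y + (T₁.filter fun t => (f₁ t).1 = y).card ≤ 12 := by
        intro y _
        set fib₁ := T₁.filter fun t => (f₁ t).1 = y with hfib₁
        by_cases hemp : fib₁ = ∅
        · rw [hemp, Finset.card_empty]; have := hdeg12 y; omega
        have hdegy : deg y ≤ 11 := by
          obtain ⟨t, ht⟩ := Finset.nonempty_iff_ne_empty.2 hemp
          obtain ⟨htT, hty⟩ := Finset.mem_filter.1 ht; have := (hend₁ t htT).2.1; rw [hty] at this; exact this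
        set ES₁ := fib₁.image f₁ with hES₁
        have hc₁ : ES₁.card = fib₁.card := Finset.card_image_of_injOn fun t ht t' ht' hft =>
          hinj₁ t (Finset.mem_filter.1 ht).1 t' (Finset.mem_filter.1 ht').1 hft
        have key := card_contacts_add_endStates_le_twelve_sep hX hDS hCP M₁ (∅ : Set _)
          (fun F₁ _ F₂ hF₂ => absurd hF₂ (Set.notMem_empty F₂)) hbb
          (z₁ := z) (z₂ := -e₃) hdegy ES₁ (∅ : Finset _) (fun s hs => ?_) (fun s hs => absurd hs (Finset.notMem_empty s))
        · rw [hc₁, Finset.card_empty, add_zero] at key; exact key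
        · obtain ⟨t, ht, rfl⟩ := Finset.mem_image.1 hs
          obtain ⟨htT, hty⟩ := Finset.mem_filter.1 ht
          obtain ⟨-, -, hI, hW, hlast, hC, hfr, -⟩ := hend₁ t htT
          rw [hty] at hC; exact ⟨hty, hI, hW, hlast, hC, hfr⟩
      -- summing over the end classes
      have hsum₁ : T₁.card = ∑ y ∈ PAYin ∪ RIM, (T₁.filter fun t => (f₁ t).1 = y).card :=
        Finset.card_eq_sum_card_fiberwise fun t ht => hendD t ht
      have hcountD : (T₁.card : ℝ) ≤ ∑ y ∈ PAYin ∪ RIM, ((12 : ℝ) - ((X.filter fun q => dist y q = 1).card : ℝ)) := by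
        rw [hsum₁]
        push_cast
        refine Finset.sum_le_sum fun y hy => ?_
        have := hpt y hy
        have h' : (deg y : ℝ) + ((T₁.filter fun t => (f₁ t).1 = y).card : ℝ) ≤ 12 := by exact_mod_cast this
        simp only [hdeg] at h'
        linarith
      have hsplitD : ∑ y ∈ PAYin ∪ RIM, ((12 : ℝ) - ((X.filter fun q => dist y q = 1).card : ℝ)) ≤
          (∑ y ∈ PAY, ((12 : ℝ) - ((X.filter fun q => dist y q = 1).card : ℝ))) + 12 * (RIM.card : ℝ) := by
        rw [Finset.sum_union hdisj]
        have h1 : ∑ y ∈ PAYin, ((12 : ℝ) - ((X.filter fun q => dist y q = 1).card : ℝ)) ≤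
            ∑ y ∈ PAY, ((12 : ℝ) - ((X.filter fun q => dist y q = 1).card : ℝ)) :=
          Finset.sum_le_sum_of_subset_of_nonneg (by rw [hPAYin]; exact Finset.filter_subset _ _) fun y _ _ => by
            have h'' : ((X.filter fun q => dist y q = 1).card : ℝ) ≤ 12 := by exact_mod_cast hdeg12 y
            linarith
        have h2 : ∑ y ∈ RIM, ((12 : ℝ) - ((X.filter fun q => dist y q = 1).card : ℝ)) ≤ ∑ y ∈ RIM, (12 : ℝ) :=
          Finset.sum_le_sum fun y _ => by
            have h'' : (0 : ℝ) ≤ ((X.filter fun q => dist y q = 1).card : ℝ) := Nat.cast_nonneg _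
            linarith
        rw [Finset.sum_const, nsmul_eq_mul] at h2
        linarith
      have hrim' : 12 * (RIM.card : ℝ) ≤ 24192 * (1 + h) * ρ := by
        have h1 : (RIM.card : ℝ) ≤ 48 * (h + 2 * 10 - -(2 * 10) + 2) * (ρ - 1) := by exact_mod_cast hRIMcard
        nlinarith only [h1, hh, hρ1, hhρ]
      have hflux' : (128 + 16 * L) * ρ ≤ (128 + 16 * L) * ((1 + h) * ρ) :=
        mul_le_mul_of_nonneg_left (by nlinarith only [hh, hρ0]) (by positivity)
      have hCm' : Cm * (1 + h) * ρ = (128 + 16 * L) * ((1 + h) * ρ) + 24192 * (1 + h) * ρ := by rw [hCm]; ring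
      linarith only [hcountD, hsplitD, hrim', hT₁'', hflux', hCm']
    · -- SMALL CELL: the flux is within the error
      push Not at hbig
      have hsmall : κ₁ * Real.pi * ρ ^ 2 ≤ Cm * (1 + h) * ρ := by
        have h1 : κ₁ * Real.pi ≤ 8 := by nlinarith only [hκ₁0, hκ₁2, hπ, hπ0]
        have h2 : κ₁ * Real.pi * ρ ^ 2 ≤ 8 * ρ ^ 2 := mul_le_mul_of_nonneg_right h1 (sq_nonneg ρ)
        have h3 : ρ ^ 2 ≤ ρ * (11 + L) := by rw [sq]; exact mul_le_mul_of_nonneg_left hbig.le hρ0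
        have h4 : 8 * (ρ * (11 + L)) ≤ Cm * ρ := by
          rw [hCm]; nlinarith only [hρ0, hL0]
        have h5 : Cm * ρ ≤ Cm * (1 + h) * ρ := by nlinarith only [hCm0, hh, hρ0, hhρ]
        linarith only [h2, h3, h4, h5]
      linarith only [hsmall, hPAY0]
  -- the two upper slab counts and the two splits
  have hD₁ := hC₁ (-(2 * 10)) (-10) (by ring) ρ hρ P₁ hP₁; have hD₂ := hC₂ (h + 10) (h + 2 * 10) (by ring) ρ hρ P₂ hP₂
  have hsplit₁ := contactDeficiency_sdiff_split hP₁X; have hsplit₂ := contactDeficiency_sdiff_split hP₂X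
  have htwo := two_mul_contactDeficiency_eq_sum X; have hhρ : 0 ≤ h * ρ := mul_nonneg hh hρ0
  -- constants
  have hb : C₁ * ρ ≤ |C₁| * (1 + h) * ρ := by
    have h1 : 0 ≤ (|C₁| - C₁) * ρ := mul_nonneg (by linarith only [le_abs_self C₁]) hρ0
    have h2 : 0 ≤ |C₁| * h * ρ := by positivity
    linarith only [h1, h2]
  have hc' : C₂ * ρ ≤ |C₂| * (1 + h) * ρ := by
    have h1 : 0 ≤ (|C₂| - C₂) * ρ := mul_nonneg (by linarith only [le_abs_self C₂]) hρ0
    have h2 : 0 ≤ |C₂| * h * ρ := by positivity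
    linarith only [h1, h2]
  -- assemble
  set SP : ℝ := ∑ y ∈ PAY, ((12 : ℝ) - ((X.filter fun q => dist y q = 1).card : ℝ)) with hSP
  set C₀ : ℝ := 240 * Real.sqrt 2 * Real.pi + 4440 * (4 * 10 + 2) with hC₀
  have hDX : φ₁ * Real.pi * ρ ^ 2 + φ₂ * Real.pi * ρ ^ 2 + SP / 2 - C₀ * (1 + h) * ρ / 2 ≤ contactDeficiency X := by linarith only [hled, htwo]
  have hcross : ((((P₁ ×ˢ (X \ P₁)).filter fun pq => dist pq.1 pq.2 = 1).card : ℕ) : ℝ) +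
      ((((P₂ ×ˢ ((X \ P₁) \ P₂)).filter fun pq => dist pq.1 pq.2 = 1).card : ℕ) : ℝ) =
      contactDeficiency P₁ + contactDeficiency P₂ + contactDeficiency ((X \ P₁) \ P₂) - contactDeficiency X := by linarith only [hsplit₁, hsplit₂]
  rw [hcross]
  have hSP : κ₁ * Real.pi * ρ ^ 2 / 2 - Cm * (1 + h) * ρ / 2 ≤ SP / 2 := by linarith only [hmain]
  have hC₀0 : 0 ≤ C₀ * (1 + h) * ρ := by positivity
  have hCm1 : 0 ≤ Cm * (1 + h) * ρ := by positivity
  linarith only [hDX, hSP, hD₁, hD₂, hb, hc', hC₀0, hCm1]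

end Summit.Ventures.Crystal3D.Theorems

end
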